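import Summits.HodgeConjecture.HodgeConjecture.Theorems.MarkmanPartnerTransportPicardThreeK3SquaresSquareOfGenerator
import Summits.HodgeConjecture.HodgeConjecture.Theorems.MarkmanPartnerTransportPartnerTransport
import HarnessLib

/-!
# A model EXAMPLE inside the regime of crux `LowPicardRealMultiplication`: the van Geemen–Schütt degree-2 K3
# surfaces with RM by `ℚ(√5)` (`ρ = 2`) — HC⁴ of their squares and of their Hilbert squares
# (route `MarkmanPartnerTransport`, `--supports stmt-HodgeConjecture-19653`; cell `hodge-nonav`, target T4 «vGS-5A»)

Prover seat `hodge-nonav-19716-p2` (g5), task T4 of planner P1 g37 (STATUS 12:17:36Z). Sorry-free, no definition, no new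
named fact in this file; CONDITIONAL on the named existence fact
`VanGeemenSchuett2025_rmK3_cycleInduced_sqrt5_degreeTwo` (van Geemen–Schütt, Forum Math. Sigma 13 (2025) e2 =
arXiv:2310.05196, Thm. 1.1 (5) with §5.9, Prop. 4.6, §4.8: the 7-dimensional family of degree-`2` K3 surfaces — Dickson
deformations of the Artebani–Sarti–Taki double planes `w² = p(x₀,x₁) + x₁x₂⁵` — has very general `ρ = 2` and RM by
`ℚ(√5)`, the generator being induced by the push-forward of the graph cycle `Γ₁ + Γ₋₁` of the `D₅`-Galois cover) and,
for the Hilbert square, on Beauville's blow-up description (`Beauville1983_hilbertSquare_blowupDiagonal_surjection`).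
Nothing here says HC ∕ HC_AV is proved; rung F-H1 is not moved.

WHY IT MATTERS (memo ROUTE-P1AJ §C.5–§C.6, INDEX row HK-K3[2]-PARTNERED ∕ crux #5): for such an `S` the Hilbert
square `X = S^{[2]}` has `ρ(X) = 3`, `E(X) = ℚ(√5)` totally real `≠ ℚ`, `rk T(X) = 20` — INSIDE the regime the crux
`LowPicardRealMultiplication` describes as having "no algebraic source for `t_e` on any HK fourfold in print"; for THIS
`X` the source is in print (loc. cit. §4.8 + §5.9) and the tree's pipeline
`IsCycleInducedRMK3 ⟹ HC⁴(S × S)` (`SquareOfGenerator.hodgeConjectureFor_tensor_self_of_isCycleInducedRMK3`)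
`⟹ HC⁴(S^{[2]})` (`PartnerLattice.hodgeConjectureFor_hilbertSquare_of_square`) applies verbatim:

* `exists_rmK3_sqrt5_picardTwo_hodgeConjectureFor_square` — `∃ S` K3, `ρ(S) = 2`, not CM, cycle-induced RM by
  `ℚ(√5)`, with `HodgeConjectureFor 4 (S ⊗ S)`;
* `exists_rmK3_sqrt5_picardTwo_hodgeConjectureFor_hilbertSquare` — the same `S` with, in addition,
  `HodgeConjectureFor 4 H` for every smooth projective Hilbert square `H = S^{[2]}` (`IsHilbertSchemeOfPoints 2 S H Ξ`).

## References

* [GeemenSchutt2023] B. van Geemen, M. Schütt, On families of K3 surfaces with real multiplication, Forum Math. Sigma 13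
  (2025) e2, arXiv:2310.05196: Thm. 1.1 (5), §5.9, Prop. 4.6, §4.8, Rem. 4.9.
* [Beauville1983] A. Beauville, Variétés kählériennes dont la première classe de Chern est nulle, J. Diff. Geom. 18
  (1983), §6.
* [Buskin2019] N. Buskin, Every rational Hodge isometry between two K3 surfaces is algebraic, J. reine angew. Math. 755
  (2019), Thm. 1.1.
-/

noncomputable section

open Module CategoryTheory MonoidalCategory Polynomial
open Literature.AlgebraicGeometry Literature.AlgebraicGeometry.Motives Literature.AlgebraicGeometry.HodgeTheory
open Literature.AlgebraicGeometry.Hyperkaehler Literature.AlgebraicGeometry.HilbertScheme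
open Literature.AlgebraicGeometry.Surfaces
open Literature.AlgebraicTopology.SingularHomology

-- mandated namespace `Summit.HodgeConjecture.HodgeConjecture.Theorems` trips `linter.dupNamespace` (off tree-wide)
set_option linter.dupNamespace false

namespace Summit.HodgeConjecture.HodgeConjecture.Theorems.MarkmanPartnerTransport.LowPicardRMModelExample

/-- **Model example (van Geemen–Schütt Thm. 1.1 (5)): a K3 surface of Picard number `2` with cycle-induced real
multiplication by `ℚ(√5)`, not of CM type, whose square satisfies the Hodge conjecture** — one line from the tree's
`SquareOfGenerator.exists_rmK3_hodgeConjectureFor_square_of_exists`; CONDITIONAL exactly on the existence fact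
`VanGeemenSchuett2025_rmK3_cycleInduced_sqrt5_degreeTwo` (the pipeline's other inputs — Buskin, Zarhin, the K3 lattice
facts — are those already displayed by `hodgeConjectureFor_tensor_self_of_isCycleInducedRMK3`).
[cite: GeemenSchutt2023, Thm. 1.1 (5), §5.9 and §4.8] -/
theorem exists_rmK3_sqrt5_picardTwo_hodgeConjectureFor_square
    (h : VanGeemenSchuett2025_rmK3_cycleInduced_sqrt5_degreeTwo) :
    ∃ S : SchemeOver ℂ, IsK3Surface S ∧ Module.finrank ℂ ↥(algebraicClasses S 1) = 2 ∧
      ¬ HasComplexMultiplication S ∧ IsCycleInducedRMK3 S 2 (X ^ 2 + X - 1) ∧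
      HodgeConjectureFor 4 (S ⊗ S) :=
  SquareOfGenerator.exists_rmK3_hodgeConjectureFor_square_of_exists h

/-- **Model example, Hilbert-square form: an HK fourfold `X = S^{[2]}` with `ρ(X) = 3`, `E(X) = ℚ(√5)` — inside the
regime of crux `LowPicardRealMultiplication` — for which HC⁴ holds** (modulo the existence fact and Beauville's
blow-up description of `S^{[2]}`): the K3 surface `S` of Thm. 1.1 (5) has `HC⁴(S × S)`, and
`PartnerLattice.hodgeConjectureFor_hilbertSquare_of_square` transports it to every smooth projective Hilbert square
`H` of `S` (`Bl_Δ(S × S) ↠ S^{[2]}`). [cite: GeemenSchutt2023, Thm. 1.1 (5), §5.9 and §4.8] [cite: Beauville1983, §6] -/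
theorem exists_rmK3_sqrt5_picardTwo_hodgeConjectureFor_hilbertSquare
    (hBl : Beauville1983_hilbertSquare_blowupDiagonal_surjection)
    (h : VanGeemenSchuett2025_rmK3_cycleInduced_sqrt5_degreeTwo) :
    ∃ S : SchemeOver ℂ, IsK3Surface S ∧ Module.finrank ℂ ↥(algebraicClasses S 1) = 2 ∧
      ¬ HasComplexMultiplication S ∧ IsCycleInducedRMK3 S 2 (X ^ 2 + X - 1) ∧
      HodgeConjectureFor 4 (S ⊗ S) ∧
      ∀ (H : SchemeOver ℂ) (Ξ : (S ⊗ H).left.IdealSheafData), IsHilbertSchemeOfPoints 2 S H Ξ →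
        IsSmoothProjective 4 H → HodgeConjectureFor 4 H := by
  obtain ⟨S, hK3, hρ, hCM, hRM, hSS⟩ := exists_rmK3_sqrt5_picardTwo_hodgeConjectureFor_square h
  exact ⟨S, hK3, hρ, hCM, hRM, hSS, fun H Ξ hHilb hH ↦
    PartnerLattice.hodgeConjectureFor_hilbertSquare_of_square hBl hK3.isSmoothProjective hHilb hH hSS⟩

/-! ### T5 «ζ₁₁-SQUARE» (planner P1 g37, STATUS 12:44:29Z; prover seat `hodge-nonav-19716-p2` g6): the second
populated cell `(ρ(X), d) = (3, 5)` of the crux-#5 cell map — van Geemen–Schütt Thm. 1.1 (11) (= Thm. 1.2 (11) of the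
printed version, Forum Math. Sigma 13 (2025) e2), the 2-dimensional family of elliptic K3 surfaces
`y² = x³ + bx + (c₁ p_{11,a}(t) + c₀)` with very general `Pic = U`, `T = U² ⊕ E₈²`, `ρ = 2` and RM by the quintic
field `ℚ(ζ₁₁ + ζ₁₁⁻¹)`, the generator induced by the push-forward of the graph cycle `Γ₁ + Γ₋₁` (§4.8). Same two
one-line proofs as T4 with the existence fact `VanGeemenSchuett2025_rmK3_cycleInduced_zeta11` in place of
`…_sqrt5_degreeTwo`. CONDITIONAL on that fact (and on Beauville for the Hilbert square); HC not proved. -/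

/-- **Model example (van Geemen–Schütt Thm. 1.1 (11)): a K3 surface of Picard number `2` with cycle-induced real
multiplication by the quintic field `ℚ(ζ₁₁ + ζ₁₁⁻¹)` (minimal polynomial `X⁵ + X⁴ − 4X³ − 3X² + 3X + 1`), not of CM
type, whose square satisfies the Hodge conjecture** — one line from the tree's
`SquareOfGenerator.exists_rmK3_hodgeConjectureFor_square_of_exists`; CONDITIONAL exactly on the existence fact
`VanGeemenSchuett2025_rmK3_cycleInduced_zeta11`. For the Hilbert square `X = S^{[2]}` this is the cell
`(ρ(X), d) = (3, 5)` of crux `LowPicardRealMultiplication` (`rk T(X) = 20 = 4·5`).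
[cite: GeemenSchutt2023, Thm. 1.1 (11), Prop. 4.6, §4.8 and §5.8] -/
theorem exists_rmK3_zeta11_picardTwo_hodgeConjectureFor_square
    (h : VanGeemenSchuett2025_rmK3_cycleInduced_zeta11) :
    ∃ S : SchemeOver ℂ, IsK3Surface S ∧ Module.finrank ℂ ↥(algebraicClasses S 1) = 2 ∧
      ¬ HasComplexMultiplication S ∧ IsCycleInducedRMK3 S 2 (X ^ 5 + X ^ 4 - 4 * X ^ 3 - 3 * X ^ 2 + 3 * X + 1) ∧
      HodgeConjectureFor 4 (S ⊗ S) :=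
  SquareOfGenerator.exists_rmK3_hodgeConjectureFor_square_of_exists h

/-- **Model example, Hilbert-square form (cell `(3, 5)`): an HK fourfold `X = S^{[2]}` with `ρ(X) = 3`,
`E(X) = ℚ(ζ₁₁ + ζ₁₁⁻¹)` quintic totally real — inside the regime of crux `LowPicardRealMultiplication` — for which HC⁴
holds** (modulo the existence fact and Beauville's blow-up description of `S^{[2]}`): the K3 surface `S` of
Thm. 1.1 (11) has `HC⁴(S × S)`, and `PartnerLattice.hodgeConjectureFor_hilbertSquare_of_square` transports it to every
smooth projective Hilbert square `H` of `S` (`Bl_Δ(S × S) ↠ S^{[2]}`).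
[cite: GeemenSchutt2023, Thm. 1.1 (11), Prop. 4.6, §4.8 and §5.8] [cite: Beauville1983, §6] -/
theorem exists_rmK3_zeta11_picardTwo_hodgeConjectureFor_hilbertSquare
    (hBl : Beauville1983_hilbertSquare_blowupDiagonal_surjection)
    (h : VanGeemenSchuett2025_rmK3_cycleInduced_zeta11) :
    ∃ S : SchemeOver ℂ, IsK3Surface S ∧ Module.finrank ℂ ↥(algebraicClasses S 1) = 2 ∧
      ¬ HasComplexMultiplication S ∧ IsCycleInducedRMK3 S 2 (X ^ 5 + X ^ 4 - 4 * X ^ 3 - 3 * X ^ 2 + 3 * X + 1) ∧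
      HodgeConjectureFor 4 (S ⊗ S) ∧
      ∀ (H : SchemeOver ℂ) (Ξ : (S ⊗ H).left.IdealSheafData), IsHilbertSchemeOfPoints 2 S H Ξ →
        IsSmoothProjective 4 H → HodgeConjectureFor 4 H := by
  obtain ⟨S, hK3, hρ, hCM, hRM, hSS⟩ := exists_rmK3_zeta11_picardTwo_hodgeConjectureFor_square h
  exact ⟨S, hK3, hρ, hCM, hRM, hSS, fun H Ξ hHilb hH ↦
    PartnerLattice.hodgeConjectureFor_hilbertSquare_of_square hBl hK3.isSmoothProjective hHilb hH hSS⟩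

end Summit.HodgeConjecture.HodgeConjecture.Theorems.MarkmanPartnerTransport.LowPicardRMModelExample

end
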